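import Summits.QuantumFields.YangMills.Theorems.EquipartitionCriticalityEquipartitionPinsProbeTangentSteinCore
import Summits.QuantumFields.YangMills.Theorems.EquipartitionCriticalityEquipartitionPinsProbeTangentShiftDerivField
import Summits.QuantumFields.YangMills.Theorems.EquipartitionCriticalityEquipartitionPinsProbeTangentShiftDerivAction
import HarnessLib

/-!
# Finite-`β` Stein identity, part 3: the defects for a link (crux `stmt-QuantumFields-8760`, line `Sketch`, STUB TS7)

`defect_pair`: the abstract core estimate (`core_defect`, part 2) for the rescaled plaquette field
`Y^β = plaqField r β` with `Fn = cos` and `Fn = sin`. `defect_le`: for a given link `e`, the left family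
(non-comb or forward comb link) or the right family (backward comb link) of part 1 is a flow by STUB TS0
(`stub_combShift`), satisfies the skew Haar-shift identity under every torus-limit state by STUB TS2
(`stub_haarShiftLimit`), and the derivative statements of STUBS TS3/TS4 (hypotheses `h3`, `h4`) feed
`defect_pair`; the result is the pair of trigonometric single-edge Stein defects bounded by
`∫ ∑ |h|(θ/2 + K W/(2θ)) dμ + K√β ∫ ∑ W dμ`, `W` the comb-gauge link energies.
Reference: S. Chatterjee, arXiv:1602.01222 §§9–11. [arXiv160201222]
-/

noncomputable section

open MeasureTheory Filter Topology
open scoped Matrix Matrix.Norms.Frobenius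
open Literature.Probability.LatticeModels Literature.MathematicalPhysics.QuantumLattice
open Literature.MathematicalPhysics.QuantumFieldTheory hiding ZdEdge IsLocalObservable IsInfiniteVolumeLimit

namespace Summit.QuantumFields.YangMills.Theorems.EquipartitionPinsProbe

namespace TangentSteinFiniteBeta

/-! ### The two trigonometric defects for a concrete shift family -/

section Pair

variable {G : Type} [Group G] [TopologicalSpace G] [IsTopologicalGroup G] [CompactSpace G]
  [MeasurableSpace G] [BorelSpace G] [SecondCountableTopology G]

/-- **Both trigonometric defects** of the single-edge Stein identity for the rescaled plaquette field
under a probability measure `μ`, for a one-link shift flow `T` of the link `e` with sign `σ` satisfying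
the skew Haar-shift identity for every bounded continuous cylinder observable: `core_defect` with
`Fn = cos` and `Fn = sin`. -/
theorem defect_pair (r : LatticeRep G) {β : ℝ} (hβ : 0 < β) (μ : Measure (LGConfig 4 G)) [IsProbabilityMeasure μ]
    (e : Literature.MathematicalPhysics.QuantumLattice.ZdEdge 4) (b : Fin (lieDim r)) (S : Finset (ZdPlaquette 4))
    (hS : plaquettesTouching ({e} : Finset (Literature.MathematicalPhysics.QuantumLattice.ZdEdge 4)) ⊆ S)
    (h : ZdPlaquette 4 → Fin (lieDim r) → ℝ) (σ : ℝ) (hσ : σ = 1 ∨ σ = -1)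
    (T : ℝ → LGConfig 4 G → LGConfig 4 G) (hT0 : ∀ U, T 0 U = U) (hflow : ∀ s t U, T (t + s) U = T t (T s U))
    (hTc : Continuous fun q : ℝ × LGConfig 4 G => T q.1 q.2) (K : ℝ) (hK : 0 ≤ K)
    (hY : ∀ (U : LGConfig 4 G) (p : ZdPlaquette 4) (a : Fin (lieDim r)), ∃ err : ℝ,
      HasDerivAt (fun t => plaqField r β (T t U) p a)
        (Real.sqrt β * (σ * (if a = b then plaquetteCurl (fun e' => if e' = e then (1 : ℝ) else 0) p else 0) + err)) 0 ∧
      err ^ 2 ≤ K * ∑ i : Fin 4, ((r.N : ℝ) - (r.ρ (axialFix U (plaquetteBoundary p i))).trace.re))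
    (hD : ∀ U : LGConfig 4 G, ∃ D : ℝ, HasDerivAt (fun t => wilsonBoundaryAction r.ρ {e} (T t U)) D 0 ∧
      |Real.sqrt β * D - σ * ∑ q ∈ plaquettesTouching ({e} : Finset (Literature.MathematicalPhysics.QuantumLattice.ZdEdge 4)),
          plaquetteCurl (fun e' => if e' = e then (1 : ℝ) else 0) q * plaqField r β U q b| ≤
        K * Real.sqrt β * ∑ q ∈ plaquettesTouching ({e} : Finset (Literature.MathematicalPhysics.QuantumLattice.ZdEdge 4)),
          ∑ i : Fin 4, ((r.N : ℝ) - (r.ρ (axialFix U (plaquetteBoundary q i))).trace.re))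
    (hHaar : ∀ (F : LGConfig 4 G → ℝ) (SF : Finset (Literature.MathematicalPhysics.QuantumLattice.ZdEdge 4)),
      IsCylinder F SF → Continuous F → (∃ C : ℝ, ∀ U, |F U| ≤ C) →
      ∀ t : ℝ, ∫ U, F (T t U) ∂μ =
        ∫ U, F U * Real.exp (-(β * (wilsonBoundaryAction r.ρ {e} (T (-t) U) - wilsonBoundaryAction r.ρ {e} U))) ∂μ)
    {θ : ℝ} (hθ : 0 < θ) :
    |(∑ p ∈ S, plaquetteCurl (fun e' => if e' = e then (1 : ℝ) else 0) p * h p b) *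
          (∫ U, Real.sin (∑ p ∈ S, ∑ a, h p a * plaqField r β U p a) ∂μ) +
        ∫ U, Real.cos (∑ p ∈ S, ∑ a, h p a * plaqField r β U p a) *
          (∑ p ∈ S, plaquetteCurl (fun e' => if e' = e then (1 : ℝ) else 0) p * plaqField r β U p b) ∂μ| ≤
      (∫ U, ∑ p ∈ S, ∑ a, |h p a| * (θ / 2 +
          K * (∑ i : Fin 4, ((r.N : ℝ) - (r.ρ (axialFix U (plaquetteBoundary p i))).trace.re)) / (2 * θ)) ∂μ) +
        K * Real.sqrt β * ∫ U, ∑ q ∈ plaquettesTouching ({e} : Finset (Literature.MathematicalPhysics.QuantumLattice.ZdEdge 4)),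
          ∑ i : Fin 4, ((r.N : ℝ) - (r.ρ (axialFix U (plaquetteBoundary q i))).trace.re) ∂μ ∧
    |(∫ U, Real.sin (∑ p ∈ S, ∑ a, h p a * plaqField r β U p a) *
          (∑ p ∈ S, plaquetteCurl (fun e' => if e' = e then (1 : ℝ) else 0) p * plaqField r β U p b) ∂μ) -
        (∑ p ∈ S, plaquetteCurl (fun e' => if e' = e then (1 : ℝ) else 0) p * h p b) *
          ∫ U, Real.cos (∑ p ∈ S, ∑ a, h p a * plaqField r β U p a) ∂μ| ≤
      (∫ U, ∑ p ∈ S, ∑ a, |h p a| * (θ / 2 +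
          K * (∑ i : Fin 4, ((r.N : ℝ) - (r.ρ (axialFix U (plaquetteBoundary p i))).trace.re)) / (2 * θ)) ∂μ) +
        K * Real.sqrt β * ∫ U, ∑ q ∈ plaquettesTouching ({e} : Finset (Literature.MathematicalPhysics.QuantumLattice.ZdEdge 4)),
          ∑ i : Fin 4, ((r.N : ℝ) - (r.ρ (axialFix U (plaquetteBoundary q i))).trace.re) ∂μ := by
  -- common data for `core_defect`
  have hYc : ∀ (p : ZdPlaquette 4) (a : Fin (lieDim r)), Continuous fun U : LGConfig 4 G => plaqField r β U p a :=
    fun p a => TangentPlaqFieldContinuous.continuous_plaqField_apply r β p a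
  have hWc : ∀ p : ZdPlaquette 4, Continuous fun U : LGConfig 4 G =>
      ∑ i : Fin 4, ((r.N : ℝ) - (r.ρ (axialFix U (plaquetteBoundary p i))).trace.re) := fun p =>
    continuous_finsetSum _ fun i _ => continuous_const.sub
      (Complex.continuous_re.comp ((r.continuous.comp (TangentPlaqFieldContinuous.continuous_axialFix _)).matrix_trace))
  have hSec : Continuous (wilsonBoundaryAction (G := G) r.ρ {e}) :=
    (TangentHaarShiftLimit.continuous_bounded_boundaryAction (G := G) r.ρ r.continuous {e}).1
  have hδ0 : ∀ p ∈ S, p ∉ plaquettesTouching ({e} : Finset (Literature.MathematicalPhysics.QuantumLattice.ZdEdge 4)) →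
      plaquetteCurl (fun e' => if e' = e then (1 : ℝ) else 0) p = 0 := fun p _ hp => curl_indicator_eq_zero hp
  -- the Haar identity for the two test observables
  obtain ⟨SFc, hcylc, hcc, hcb⟩ := cylinder_test r β S h Real.cos Real.continuous_cos (fun x => Real.abs_cos_le_one x)
  obtain ⟨SFs, hcyls, hsc, hsb⟩ := cylinder_test r β S h Real.sin Real.continuous_sin (fun x => Real.abs_sin_le_one x)
  have hHc := hHaar _ SFc hcylc hcc ⟨1, hcb⟩
  have hHs := hHaar _ SFs hcyls hsc ⟨1, hsb⟩
  -- `Fn = cos`, `Fn' = -sin`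
  have h1 := core_defect μ hβ S _ hS b h (fun p => plaquetteCurl (fun e' => if e' = e then (1 : ℝ) else 0) p) hδ0
    (by norm_num : (0 : ℝ) ≤ 4) (fun p => abs_curl_indicator_le e p) σ hσ T hT0 hflow hTc (plaqField r β) hYc
    (fun U p => ∑ i : Fin 4, ((r.N : ℝ) - (r.ρ (axialFix U (plaquetteBoundary p i))).trace.re)) hWc
    (wilsonBoundaryAction r.ρ {e}) hSec (fun U => ∑ p ∈ S, ∑ a, h p a * plaqField r β U p a) (fun U => rfl)
    (fun U => ∑ p ∈ S, plaquetteCurl (fun e' => if e' = e then (1 : ℝ) else 0) p * plaqField r β U p b) (fun U => rfl)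
    K hK hY hD Real.cos (fun x => -Real.sin x) Real.hasDerivAt_cos Real.continuous_sin.neg
    (fun x => Real.abs_cos_le_one x) (fun x => by rw [abs_neg]; exact Real.abs_sin_le_one x) Real.abs_cos_sub_cos_le hHc hθ
  -- `Fn = sin`, `Fn' = cos`
  have h2 := core_defect μ hβ S _ hS b h (fun p => plaquetteCurl (fun e' => if e' = e then (1 : ℝ) else 0) p) hδ0
    (by norm_num : (0 : ℝ) ≤ 4) (fun p => abs_curl_indicator_le e p) σ hσ T hT0 hflow hTc (plaqField r β) hYc
    (fun U p => ∑ i : Fin 4, ((r.N : ℝ) - (r.ρ (axialFix U (plaquetteBoundary p i))).trace.re)) hWc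
    (wilsonBoundaryAction r.ρ {e}) hSec (fun U => ∑ p ∈ S, ∑ a, h p a * plaqField r β U p a) (fun U => rfl)
    (fun U => ∑ p ∈ S, plaquetteCurl (fun e' => if e' = e then (1 : ℝ) else 0) p * plaqField r β U p b) (fun U => rfl)
    K hK hY hD Real.sin Real.cos Real.hasDerivAt_sin Real.continuous_cos
    (fun x => Real.abs_sin_le_one x) (fun x => Real.abs_cos_le_one x) Real.abs_sin_sub_sin_le hHs hθ
  refine ⟨?_, ?_⟩
  · rw [integral_neg] at h1
    rwa [show ∀ κ I J : ℝ, |κ * -I - J| = |κ * I + J| from fun κ I J => by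
      rw [← abs_neg]; congr 1; ring] at h1
  · rwa [abs_sub_comm] at h2

/-- **The defects for a given link `e`**: choose the left family (non-comb link, or forward comb link)
or the right family (backward comb link), feed STUB TS0 (`stub_combShift`, flow property), the derivative
statements of STUBS TS3/TS4 (hypotheses `h3`, `h4`) and STUB TS2 (`stub_haarShiftLimit`) into
`defect_pair`. -/
theorem defect_le [T2Space G] (r : LatticeRep G) (b : Fin (lieDim r)) {k : ℝ → G}
    (hk : ∀ t : ℝ, r.ρ (k t) = NormedSpace.exp ((t : ℂ) • lieVec r b))
    {K₃ K₄ K : ℝ} (hK0 : 0 ≤ K) (hK3 : K₃ ≤ K) (hK4 : K₄ ≤ K)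
    (h3 : ∀ (β : ℝ) (U : LGConfig 4 G) (e : Literature.MathematicalPhysics.QuantumLattice.ZdEdge 4)
      (p : ZdPlaquette 4) (a : Fin (lieDim r)),
      (((¬ ∀ j : Fin 4, e.2 < j → e.1 j = 0) ∨ 0 ≤ e.1 e.2) → ∃ err : ℝ,
        HasDerivAt (fun t : ℝ => plaqField r β (Function.update U e
            ((combTransport U e.1)⁻¹ * k t * combTransport U e.1 * U e)) p a)
          (Real.sqrt β * ((if a = b then plaquetteCurl (fun e' => if e' = e then (1 : ℝ) else 0) p else 0) + err)) 0 ∧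
        err ^ 2 ≤ K₃ * ∑ i : Fin 4, ((r.N : ℝ) - (r.ρ (axialFix U (plaquetteBoundary p i))).trace.re)) ∧
      ((∀ j : Fin 4, e.2 < j → e.1 j = 0) → e.1 e.2 < 0 → ∃ err : ℝ,
        HasDerivAt (fun t : ℝ => plaqField r β (Function.update U e
            (U e * ((combTransport U (e.1 + Pi.single e.2 1))⁻¹ * (k t)⁻¹ *
              combTransport U (e.1 + Pi.single e.2 1)))) p a)
          (Real.sqrt β * (-(if a = b then plaquetteCurl (fun e' => if e' = e then (1 : ℝ) else 0) p else 0) + err)) 0 ∧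
        err ^ 2 ≤ K₃ * ∑ i : Fin 4, ((r.N : ℝ) - (r.ρ (axialFix U (plaquetteBoundary p i))).trace.re)))
    (h4 : ∀ (β : ℝ) (U : LGConfig 4 G) (e : Literature.MathematicalPhysics.QuantumLattice.ZdEdge 4),
      (((¬ ∀ j : Fin 4, e.2 < j → e.1 j = 0) ∨ 0 ≤ e.1 e.2) → ∃ D : ℝ,
        HasDerivAt (fun t : ℝ => wilsonBoundaryAction r.ρ {e} (Function.update U e
            ((combTransport U e.1)⁻¹ * k t * combTransport U e.1 * U e))) D 0 ∧
        |Real.sqrt β * D - ∑ q ∈ plaquettesTouching {e},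
            plaquetteCurl (fun e' => if e' = e then (1 : ℝ) else 0) q * plaqField r β U q b| ≤
          K₄ * Real.sqrt β * ∑ q ∈ plaquettesTouching {e}, ∑ i : Fin 4,
            ((r.N : ℝ) - (r.ρ (axialFix U (plaquetteBoundary q i))).trace.re)) ∧
      ((∀ j : Fin 4, e.2 < j → e.1 j = 0) → e.1 e.2 < 0 → ∃ D : ℝ,
        HasDerivAt (fun t : ℝ => wilsonBoundaryAction r.ρ {e} (Function.update U e
            (U e * ((combTransport U (e.1 + Pi.single e.2 1))⁻¹ * (k t)⁻¹ *
              combTransport U (e.1 + Pi.single e.2 1))))) D 0 ∧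
        |Real.sqrt β * D + ∑ q ∈ plaquettesTouching {e},
            plaquetteCurl (fun e' => if e' = e then (1 : ℝ) else 0) q * plaqField r β U q b| ≤
          K₄ * Real.sqrt β * ∑ q ∈ plaquettesTouching {e}, ∑ i : Fin 4,
            ((r.N : ℝ) - (r.ρ (axialFix U (plaquetteBoundary q i))).trace.re)))
    {β : ℝ} (hβ : 0 < β) (μ : Measure (LGConfig 4 G)) (hμ : μ ∈ infiniteVolumeLimitPoints (d := 4) r.ρ β)
    (e : Literature.MathematicalPhysics.QuantumLattice.ZdEdge 4) (S : Finset (ZdPlaquette 4))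
    (hS : plaquettesTouching ({e} : Finset (Literature.MathematicalPhysics.QuantumLattice.ZdEdge 4)) ⊆ S)
    (h : ZdPlaquette 4 → Fin (lieDim r) → ℝ) {θ : ℝ} (hθ : 0 < θ) :
    |(∑ p ∈ S, plaquetteCurl (fun e' => if e' = e then (1 : ℝ) else 0) p * h p b) *
          (∫ U, Real.sin (∑ p ∈ S, ∑ a, h p a * plaqField r β U p a) ∂μ) +
        ∫ U, Real.cos (∑ p ∈ S, ∑ a, h p a * plaqField r β U p a) *
          (∑ p ∈ S, plaquetteCurl (fun e' => if e' = e then (1 : ℝ) else 0) p * plaqField r β U p b) ∂μ| ≤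
      (∫ U, ∑ p ∈ S, ∑ a, |h p a| * (θ / 2 +
          K * (∑ i : Fin 4, ((r.N : ℝ) - (r.ρ (axialFix U (plaquetteBoundary p i))).trace.re)) / (2 * θ)) ∂μ) +
        K * Real.sqrt β * ∫ U, ∑ q ∈ plaquettesTouching ({e} : Finset (Literature.MathematicalPhysics.QuantumLattice.ZdEdge 4)),
          ∑ i : Fin 4, ((r.N : ℝ) - (r.ρ (axialFix U (plaquetteBoundary q i))).trace.re) ∂μ ∧
    |(∫ U, Real.sin (∑ p ∈ S, ∑ a, h p a * plaqField r β U p a) *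
          (∑ p ∈ S, plaquetteCurl (fun e' => if e' = e then (1 : ℝ) else 0) p * plaqField r β U p b) ∂μ) -
        (∑ p ∈ S, plaquetteCurl (fun e' => if e' = e then (1 : ℝ) else 0) p * h p b) *
          ∫ U, Real.cos (∑ p ∈ S, ∑ a, h p a * plaqField r β U p a) ∂μ| ≤
      (∫ U, ∑ p ∈ S, ∑ a, |h p a| * (θ / 2 +
          K * (∑ i : Fin 4, ((r.N : ℝ) - (r.ρ (axialFix U (plaquetteBoundary p i))).trace.re)) / (2 * θ)) ∂μ) +
        K * Real.sqrt β * ∫ U, ∑ q ∈ plaquettesTouching ({e} : Finset (Literature.MathematicalPhysics.QuantumLattice.ZdEdge 4)),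
          ∑ i : Fin 4, ((r.N : ℝ) - (r.ρ (axialFix U (plaquetteBoundary q i))).trace.re) ∂μ := by
  haveI : IsProbabilityMeasure μ := by
    obtain ⟨L, -, hP, -⟩ := hμ
    exact hP
  have hW0 : ∀ (U : LGConfig 4 G) (p : ZdPlaquette 4),
      0 ≤ ∑ i : Fin 4, ((r.N : ℝ) - (r.ρ (axialFix U (plaquetteBoundary p i))).trace.re) := fun U p =>
    Finset.sum_nonneg fun i _ => sub_nonneg.2 (TangentCombPoincare.re_trace_le r.ρ r.mem_unitary _)
  have hSW0 : ∀ U : LGConfig 4 G, 0 ≤ Real.sqrt β * ∑ q ∈ plaquettesTouching ({e} : Finset (Literature.MathematicalPhysics.QuantumLattice.ZdEdge 4)),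
      ∑ i : Fin 4, ((r.N : ℝ) - (r.ρ (axialFix U (plaquetteBoundary q i))).trace.re) := fun U =>
    mul_nonneg (Real.sqrt_nonneg _) (Finset.sum_nonneg fun q _ => hW0 U q)
  by_cases hc : (¬ ∀ j : Fin 4, e.2 < j → e.1 j = 0) ∨ 0 ≤ e.1 e.2
  · -- the left family, `σ = 1`
    have hinv : ∀ (U : LGConfig 4 G) (g : G), combTransport (Function.update U e g) e.1 = combTransport U e.1 := by
      intro U g
      rcases hc with hnc | hnn
      · exact CombBasics.combTransport_update_of_not_isComb U hnc g e.1
      · exact (stub_combShift G U e g).2.2.1 hnn g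
    obtain ⟨T, hTdef, hT0, hflow, hTc, hinvT⟩ := leftFamily hk e hinv
    refine defect_pair r hβ μ e b S hS h 1 (Or.inl rfl) T hT0 hflow hTc K hK0 (fun U p a => ?_) (fun U => ?_)
      (fun F SF hF hFc hFb t => ?_) hθ
    · obtain ⟨err, hd, he⟩ := (h3 β U e p a).1 hc
      refine ⟨err, ?_, he.trans (mul_le_mul_of_nonneg_right hK3 (hW0 U p))⟩
      simp only [hTdef, one_mul]
      exact hd
    · obtain ⟨D, hd, hbd⟩ := (h4 β U e).1 hc
      refine ⟨D, ?_, ?_⟩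
      · simp only [hTdef]
        exact hd
      rw [one_mul]
      refine hbd.trans ?_
      rw [mul_assoc, mul_assoc]
      exact mul_le_mul_of_nonneg_right hK4 (hSW0 U)
    · obtain ⟨Sγ, hγ, hγc⟩ := cylinder_conj (G := G) e.1 (k t)
      have hid := (stub_haarShiftLimit G r.ρ r.continuous β μ hμ e
        (fun U => (combTransport U e.1)⁻¹ * k t * combTransport U e.1) Sγ hγ hγc
        (fun U g => by simp only [hinv]) F SF hF hFc hFb).1
      simp only [hinvT] at hid
      have hT' : ∀ U : LGConfig 4 G, F (T t U) =
          F (Function.update U e ((combTransport U e.1)⁻¹ * k t * combTransport U e.1 * U e)) := fun U => by rw [hTdef]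
      simp only [hT']
      exact hid
  · -- the right family, `σ = -1`
    push Not at hc
    obtain ⟨hcomb, hneg⟩ := hc
    have hinv : ∀ (U : LGConfig 4 G) (g : G), combTransport (Function.update U e g) (e.1 + Pi.single e.2 1) =
        combTransport U (e.1 + Pi.single e.2 1) := fun U g => (stub_combShift G U e g).2.2.2 hneg g
    obtain ⟨T, hTdef, hT0, hflow, hTc, hinvT⟩ := rightFamily hk e hinv
    refine defect_pair r hβ μ e b S hS h (-1) (Or.inr rfl) T hT0 hflow hTc K hK0 (fun U p a => ?_) (fun U => ?_)
      (fun F SF hF hFc hFb t => ?_) hθ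
    · obtain ⟨err, hd, he⟩ := (h3 β U e p a).2 hcomb hneg
      refine ⟨err, ?_, he.trans (mul_le_mul_of_nonneg_right hK3 (hW0 U p))⟩
      simp only [hTdef, neg_one_mul]
      exact hd
    · obtain ⟨D, hd, hbd⟩ := (h4 β U e).2 hcomb hneg
      refine ⟨D, ?_, ?_⟩
      · simp only [hTdef]
        exact hd
      rw [neg_one_mul, sub_neg_eq_add]
      refine hbd.trans ?_
      rw [mul_assoc, mul_assoc]
      exact mul_le_mul_of_nonneg_right hK4 (hSW0 U)
    · obtain ⟨Sγ, hγ, hγc⟩ := cylinder_conj (G := G) (e.1 + Pi.single e.2 1) (k t)⁻¹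
      have hid := (stub_haarShiftLimit G r.ρ r.continuous β μ hμ e
        (fun U => (combTransport U (e.1 + Pi.single e.2 1))⁻¹ * (k t)⁻¹ * combTransport U (e.1 + Pi.single e.2 1))
        Sγ hγ hγc (fun U g => by simp only [hinv]) F SF hF hFc hFb).2
      simp only [hinvT] at hid
      have hT' : ∀ U : LGConfig 4 G, F (T t U) = F (Function.update U e (U e *
          ((combTransport U (e.1 + Pi.single e.2 1))⁻¹ * (k t)⁻¹ * combTransport U (e.1 + Pi.single e.2 1)))) :=
        fun U => by rw [hTdef]
      simp only [hT']
      exact hid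

/-- **The defects for a given link, with STUBS TS3/TS4 discharged** (`stub_shiftDerivField` with TS0
`stub_combShift`, and `stub_shiftDerivAction`): there is `K ≥ 0` (depending on `r`, `b`, `k` only) such that
for every `β > 0`, every torus-limit state `μ` at `β`, every link `e`, `S ⊇ plaquettesTouching {e}`, `h` and
`θ > 0`, both trigonometric single-edge Stein defects are bounded by
`∫ ∑ |h|(θ/2 + K W/(2θ)) dμ + K√β ∫ ∑ W dμ`. -/
theorem defect_le' [T2Space G] (r : LatticeRep G) (b : Fin (lieDim r)) {k : ℝ → G}
    (hk : ∀ t : ℝ, r.ρ (k t) = NormedSpace.exp ((t : ℂ) • lieVec r b)) :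
    ∃ K : ℝ, 0 ≤ K ∧ ∀ {β : ℝ}, 0 < β → ∀ (μ : Measure (LGConfig 4 G)), μ ∈ infiniteVolumeLimitPoints (d := 4) r.ρ β →
      ∀ (e : Literature.MathematicalPhysics.QuantumLattice.ZdEdge 4) (S : Finset (ZdPlaquette 4)),
        plaquettesTouching ({e} : Finset (Literature.MathematicalPhysics.QuantumLattice.ZdEdge 4)) ⊆ S →
        ∀ (h : ZdPlaquette 4 → Fin (lieDim r) → ℝ) {θ : ℝ}, 0 < θ →
    |(∑ p ∈ S, plaquetteCurl (fun e' => if e' = e then (1 : ℝ) else 0) p * h p b) *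
          (∫ U, Real.sin (∑ p ∈ S, ∑ a, h p a * plaqField r β U p a) ∂μ) +
        ∫ U, Real.cos (∑ p ∈ S, ∑ a, h p a * plaqField r β U p a) *
          (∑ p ∈ S, plaquetteCurl (fun e' => if e' = e then (1 : ℝ) else 0) p * plaqField r β U p b) ∂μ| ≤
      (∫ U, ∑ p ∈ S, ∑ a, |h p a| * (θ / 2 +
          K * (∑ i : Fin 4, ((r.N : ℝ) - (r.ρ (axialFix U (plaquetteBoundary p i))).trace.re)) / (2 * θ)) ∂μ) +
        K * Real.sqrt β * ∫ U, ∑ q ∈ plaquettesTouching ({e} : Finset (Literature.MathematicalPhysics.QuantumLattice.ZdEdge 4)),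
          ∑ i : Fin 4, ((r.N : ℝ) - (r.ρ (axialFix U (plaquetteBoundary q i))).trace.re) ∂μ ∧
    |(∫ U, Real.sin (∑ p ∈ S, ∑ a, h p a * plaqField r β U p a) *
          (∑ p ∈ S, plaquetteCurl (fun e' => if e' = e then (1 : ℝ) else 0) p * plaqField r β U p b) ∂μ) -
        (∑ p ∈ S, plaquetteCurl (fun e' => if e' = e then (1 : ℝ) else 0) p * h p b) *
          ∫ U, Real.cos (∑ p ∈ S, ∑ a, h p a * plaqField r β U p a) ∂μ| ≤
      (∫ U, ∑ p ∈ S, ∑ a, |h p a| * (θ / 2 +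
          K * (∑ i : Fin 4, ((r.N : ℝ) - (r.ρ (axialFix U (plaquetteBoundary p i))).trace.re)) / (2 * θ)) ∂μ) +
        K * Real.sqrt β * ∫ U, ∑ q ∈ plaquettesTouching ({e} : Finset (Literature.MathematicalPhysics.QuantumLattice.ZdEdge 4)),
          ∑ i : Fin 4, ((r.N : ℝ) - (r.ρ (axialFix U (plaquetteBoundary q i))).trace.re) ∂μ := by
  obtain ⟨K₃, h3⟩ := stub_shiftDerivField G r b k hk (stub_combShift G)
  obtain ⟨K₄, h4⟩ := stub_shiftDerivAction G r b k hk
  refine ⟨max (max K₃ K₄) 0, le_max_right _ _, ?_⟩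
  intro β hβ μ hμ e S hS h θ hθ
  exact defect_le r b hk (le_max_right _ _) ((le_max_left _ _).trans (le_max_left _ _))
    ((le_max_right _ _).trans (le_max_left _ _)) h3 h4 hβ μ hμ e S hS h hθ

end Pair

end TangentSteinFiniteBeta

/-- Registered helper stub `stub_steinDefect` of line `Sketch` (crux `stmt-QuantumFields-8760`): the statement of
`TangentSteinFiniteBeta.defect_le'` (see its docstring), fully qualified. -/
theorem stub_steinDefect :
    ∀ {G : Type} [Group G] [TopologicalSpace G] [IsTopologicalGroup G] [CompactSpace G] [MeasurableSpace G] [BorelSpace G] [SecondCountableTopology G] [T2Space G] (r : Literature.MathematicalPhysics.QuantumFieldTheory.LatticeRep G) (b : Fin (Summit.QuantumFields.YangMills.Theorems.EquipartitionPinsProbe.lieDim r)) {k : ℝ → G}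
    (hk : ∀ t : ℝ, r.ρ (k t) = NormedSpace.exp ((t : ℂ) • Summit.QuantumFields.YangMills.Theorems.EquipartitionPinsProbe.lieVec r b)),
      ∃ K : ℝ, 0 ≤ K ∧ ∀ {β : ℝ}, 0 < β → ∀ (μ : MeasureTheory.Measure (Literature.MathematicalPhysics.QuantumLattice.LGConfig 4 G)), μ ∈ Literature.MathematicalPhysics.QuantumLattice.infiniteVolumeLimitPoints (d := 4) r.ρ β →
      ∀ (e : Literature.MathematicalPhysics.QuantumLattice.ZdEdge 4) (S : Finset (Literature.MathematicalPhysics.QuantumLattice.ZdPlaquette 4)),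
        Literature.MathematicalPhysics.QuantumLattice.plaquettesTouching ({e} : Finset (Literature.MathematicalPhysics.QuantumLattice.ZdEdge 4)) ⊆ S →
        ∀ (h : Literature.MathematicalPhysics.QuantumLattice.ZdPlaquette 4 → Fin (Summit.QuantumFields.YangMills.Theorems.EquipartitionPinsProbe.lieDim r) → ℝ) {θ : ℝ}, 0 < θ →
    |(∑ p ∈ S, Literature.MathematicalPhysics.QuantumFieldTheory.plaquetteCurl (fun e' => if e' = e then (1 : ℝ) else 0) p * h p b) *
          (∫ U, Real.sin (∑ p ∈ S, ∑ a, h p a * Summit.QuantumFields.YangMills.Theorems.EquipartitionPinsProbe.plaqField r β U p a) ∂μ) +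
        ∫ U, Real.cos (∑ p ∈ S, ∑ a, h p a * Summit.QuantumFields.YangMills.Theorems.EquipartitionPinsProbe.plaqField r β U p a) *
          (∑ p ∈ S, Literature.MathematicalPhysics.QuantumFieldTheory.plaquetteCurl (fun e' => if e' = e then (1 : ℝ) else 0) p * Summit.QuantumFields.YangMills.Theorems.EquipartitionPinsProbe.plaqField r β U p b) ∂μ| ≤
      (∫ U, ∑ p ∈ S, ∑ a, |h p a| * (θ / 2 +
          K * (∑ i : Fin 4, ((r.N : ℝ) - (r.ρ (Summit.QuantumFields.YangMills.Theorems.EquipartitionPinsProbe.axialFix U (Literature.MathematicalPhysics.QuantumFieldTheory.plaquetteBoundary p i))).trace.re)) / (2 * θ)) ∂μ) +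
        K * Real.sqrt β * ∫ U, ∑ q ∈ Literature.MathematicalPhysics.QuantumLattice.plaquettesTouching ({e} : Finset (Literature.MathematicalPhysics.QuantumLattice.ZdEdge 4)),
          ∑ i : Fin 4, ((r.N : ℝ) - (r.ρ (Summit.QuantumFields.YangMills.Theorems.EquipartitionPinsProbe.axialFix U (Literature.MathematicalPhysics.QuantumFieldTheory.plaquetteBoundary q i))).trace.re) ∂μ ∧
    |(∫ U, Real.sin (∑ p ∈ S, ∑ a, h p a * Summit.QuantumFields.YangMills.Theorems.EquipartitionPinsProbe.plaqField r β U p a) *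
          (∑ p ∈ S, Literature.MathematicalPhysics.QuantumFieldTheory.plaquetteCurl (fun e' => if e' = e then (1 : ℝ) else 0) p * Summit.QuantumFields.YangMills.Theorems.EquipartitionPinsProbe.plaqField r β U p b) ∂μ) -
        (∑ p ∈ S, Literature.MathematicalPhysics.QuantumFieldTheory.plaquetteCurl (fun e' => if e' = e then (1 : ℝ) else 0) p * h p b) *
          ∫ U, Real.cos (∑ p ∈ S, ∑ a, h p a * Summit.QuantumFields.YangMills.Theorems.EquipartitionPinsProbe.plaqField r β U p a) ∂μ| ≤
      (∫ U, ∑ p ∈ S, ∑ a, |h p a| * (θ / 2 +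
          K * (∑ i : Fin 4, ((r.N : ℝ) - (r.ρ (Summit.QuantumFields.YangMills.Theorems.EquipartitionPinsProbe.axialFix U (Literature.MathematicalPhysics.QuantumFieldTheory.plaquetteBoundary p i))).trace.re)) / (2 * θ)) ∂μ) +
        K * Real.sqrt β * ∫ U, ∑ q ∈ Literature.MathematicalPhysics.QuantumLattice.plaquettesTouching ({e} : Finset (Literature.MathematicalPhysics.QuantumLattice.ZdEdge 4)),
          ∑ i : Fin 4, ((r.N : ℝ) - (r.ρ (Summit.QuantumFields.YangMills.Theorems.EquipartitionPinsProbe.axialFix U (Literature.MathematicalPhysics.QuantumFieldTheory.plaquetteBoundary q i))).trace.re) ∂μ :=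
  @TangentSteinFiniteBeta.defect_le'

end Summit.QuantumFields.YangMills.Theorems.EquipartitionPinsProbe

end
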